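import Summits.CriticalPhenomena.PercolationContinuityZ3.Theorems.PercNearOneGluingNoHeavyQuantFarTreeHubBlocksProfile
import HarnessLib

/-!
# QUANT lane R8, FAR on trees: the profile conjecture for MONOTONE hub laws, I — the reflection pairing and the
# pure one-light-block inequality

builds on p205010 (kernel theorem, internal audit signed; external expert review pending)

Support file (`--supports stmt-CriticalPhenomena-4575`), QUANT lane typer seat prim-quant-stmt (gen 13); memo
`run/shared/lean/prim/quant/prim-quant-stmt-g13/MONO-RELAXATION.md`.  Theorems only; no definitions, no sorries, standard axioms.
Part II (`…QuantMonoHubOneBlock.lean`) instantiates this file in the binder shape of `Quant.HubBlocksProfileIneq` (`K = ∅`, `K = {x}`) and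
derives FAR for 'hub + leaves + one root block' with the AVERAGE leaf gate.

The profile conjecture `Quant.HubBlocksProfileIneq` (gen 12, `…QuantHubBlocksProfileConjecture.lean`) asks, for a hub law `p` on `{0,…,m}`
with mean `μ` that is RATIO-REGULAR below the mean, that `τ ≤ Σ_b p b·(P(W ≥ j+1−b) + ((1−G)/G)·P(W ≥ j+1))` for the block sum `W` of the
root blocks.  Gen-13 finding (memo §1): numerically the WEAKER hypothesis "the pmf `p` is NONDECREASING on `[0, μ]`" already suffices
(exact census, 340 000 instances / 0 violations), and for monotone laws the extreme points are uniform windows `U[t,n] ⊕ δ_{b₁}` instead of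
Poisson shapes.  This file provides the one elementary device that proves the monotone form for `K = ∅` and `K = {x}`:

* `Quant.mono_chain`, `Quant.mono_of_ratioRegular`, `Quant.mean_le_top` — bookkeeping: successive-step monotonicity below `μ` gives
  `p b ≤ p b'` for `b ≤ b' ≤ μ`; ratio-regularity below the mean implies it; the mean is at most the top of the support.
* `Quant.reflect_pairing` — **the reflection pairing**: if `p ≥ 0` is nondecreasing on `[1, j+k]` (`k ≤ j`) and `j+k+1 ≤ M` then
  `Σ_{b ≤ k} b·p b ≤ Σ_{j < b ≤ j+k} (M − b)·p b` (pair `b ↔ j+k+1−b`).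
* `Quant.mono_profile_oneLightBlock` — for `p ≥ 0` nondecreasing on `[1, 2j−a]` (`a ≤ j`), `2j−a+1 ≤ m ≤ M`, `j ≤ M·g`:
  `Σ_{b≤m} b·p b ≤ M·Σ_{b≤m} p b·(1[j < b] + g·1[j−a < b ≤ j])`.  (With `a = 0` this is the monotone-law form of the average-gate star row
  `Quant.pb_smallBall_avg`; with `a ≥ 1` it is the two-level inequality of `Quant.twoLevel_lightBlock` for monotone laws and the average gate —
  both now three-line consequences of the reflection pairing, with no 'atom beats tail' and no Cantelli.)
* `Quant.singleton_blockSum_eq`, `Quant.singleton_blockSum_real` — the block-sum events of a single block: `P(i ≤ W) = 1, q x, 0` for `i = 0`,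
  `1 ≤ i ≤ size x`, `i > size x`.
[cite: KozmaNitzan2024, Conjecture 3 (p. 15)] (the gluing rows served); the inequalities are [this work].
-/
noncomputable section

namespace Summit.CriticalPhenomena.PercolationContinuityZ3.Theorems

namespace Quant

open Finset MeasureTheory
open Literature.Probability.LatticeModels
open Literature.Probability.Percolation
open scoped Classical

/-! ### 1. Monotone laws: bookkeeping -/

/-- Successive-step monotonicity below `μ` gives `p b ≤ p b'` for `b ≤ b' ≤ μ`. [folklore] -/
theorem mono_chain (p : ℕ → ℝ) (μ : ℝ) (hmono : ∀ b : ℕ, 1 ≤ b → (b : ℝ) ≤ μ → p (b - 1) ≤ p b)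
    {b b' : ℕ} (hbb' : b ≤ b') (hb'μ : (b' : ℝ) ≤ μ) : p b ≤ p b' := by
  induction b', hbb' using Nat.le_induction with
  | base => exact le_rfl
  | succ b' hbb' ih =>
    have h1 : (b' : ℝ) ≤ μ := by push_cast at hb'μ; linarith
    have h2 := hmono (b' + 1) (by omega) hb'μ
    simp only [Nat.add_sub_cancel] at h2
    exact (ih h1).trans h2

/-- Ratio-regularity below the mean (`μ·p(b−1) ≤ b·p b` for `1 ≤ b ≤ μ`, `μ > 0`) implies monotonicity below the mean. [folklore] -/
theorem mono_of_ratioRegular (p : ℕ → ℝ) (μ : ℝ) (hμ : 0 < μ) (hp0 : ∀ b, 0 ≤ p b)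
    (hratio : ∀ b : ℕ, 1 ≤ b → (b : ℝ) ≤ μ → μ * p (b - 1) ≤ (b : ℝ) * p b) :
    ∀ b : ℕ, 1 ≤ b → (b : ℝ) ≤ μ → p (b - 1) ≤ p b := by
  intro b hb hbμ
  have h1 := hratio b hb hbμ
  have h2 : (b : ℝ) * p b ≤ μ * p b := mul_le_mul_of_nonneg_right hbμ (hp0 b)
  exact le_of_mul_le_mul_left (h1.trans h2) hμ

/-- The mean of a law on `{0,…,m}` is at most `m`. [folklore] -/
theorem mean_le_top (p : ℕ → ℝ) (m : ℕ) (μ : ℝ) (hp0 : ∀ b, 0 ≤ p b)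
    (hsum : ∑ b ∈ Finset.range (m + 1), p b = 1) (hmean : ∑ b ∈ Finset.range (m + 1), (b : ℝ) * p b = μ) :
    μ ≤ m := by
  have : ∑ b ∈ Finset.range (m + 1), (b : ℝ) * p b ≤ ∑ b ∈ Finset.range (m + 1), (m : ℝ) * p b := by
    refine Finset.sum_le_sum fun b hb => ?_
    have : (b : ℝ) ≤ m := by have := Finset.mem_range.1 hb; exact_mod_cast (by omega)
    exact mul_le_mul_of_nonneg_right this (hp0 b)
  rw [hmean, ← Finset.mul_sum, hsum, mul_one] at this
  exact this

/-! ### 2. The reflection pairing -/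

/-- **Reflection pairing.**  If `p ≥ 0` is nondecreasing on `[1, j+k]` (`k ≤ j`) and `j+k+1 ≤ M`, then
`Σ_{b ≤ k} b·p b ≤ Σ_{j < b ≤ j+k} (M − b)·p b`: pair the level `b` with the level `j+k+1−b`, which is at least `b`, carries at least the
mass `p b`, and has weight `M − (j+k+1−b) ≥ b`. [this work] -/
theorem reflect_pairing (p : ℕ → ℝ) (j k : ℕ) (M : ℝ) (hkj : k ≤ j) (hM : (j : ℝ) + k + 1 ≤ M)
    (hp0 : ∀ b, 0 ≤ p b) (hmono : ∀ b b' : ℕ, 1 ≤ b → b ≤ b' → b' ≤ j + k → p b ≤ p b') :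
    ∑ b ∈ Finset.range (k + 1), (b : ℝ) * p b ≤ ∑ b ∈ Finset.Ioc j (j + k), (M - b) * p b := by
  -- drop the `b = 0` term
  have h1 : ∑ b ∈ Finset.range (k + 1), (b : ℝ) * p b = ∑ b ∈ Finset.Icc 1 k, (b : ℝ) * p b := by
    have e : Finset.range (k + 1) = insert 0 (Finset.Icc 1 k) := by
      ext b; simp only [Finset.mem_range, Finset.mem_insert, Finset.mem_Icc]; omega
    rw [e, Finset.sum_insert (by simp)]
    simp
  -- termwise bound against the reflected level
  have h2 : ∑ b ∈ Finset.Icc 1 k, (b : ℝ) * p b ≤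
      ∑ b ∈ Finset.Icc 1 k, (M - ((j + k + 1 - b : ℕ) : ℝ)) * p (j + k + 1 - b) := by
    refine Finset.sum_le_sum fun b hb => ?_
    rw [Finset.mem_Icc] at hb
    have hcast : ((j + k + 1 - b : ℕ) : ℝ) = (j : ℝ) + k + 1 - b := by
      rw [Nat.cast_sub (by omega)]; push_cast; ring
    have hle : (b : ℝ) ≤ M - ((j + k + 1 - b : ℕ) : ℝ) := by rw [hcast]; linarith
    have hpp : p b ≤ p (j + k + 1 - b) := hmono b _ hb.1 (by omega) (by omega)
    have hb0 : (0 : ℝ) ≤ b := Nat.cast_nonneg b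
    calc (b : ℝ) * p b ≤ (b : ℝ) * p (j + k + 1 - b) := mul_le_mul_of_nonneg_left hpp hb0
      _ ≤ (M - ((j + k + 1 - b : ℕ) : ℝ)) * p (j + k + 1 - b) := mul_le_mul_of_nonneg_right hle (hp0 _)
  -- reindex: the image of `[1, k]` under `b ↦ j+k+1−b` is `(j, j+k]`
  have h3 : ∑ b ∈ Finset.Icc 1 k, (M - ((j + k + 1 - b : ℕ) : ℝ)) * p (j + k + 1 - b) =
      ∑ b ∈ Finset.Ioc j (j + k), (M - b) * p b := by
    have hinj : Set.InjOn (fun b => j + k + 1 - b) ↑(Finset.Icc 1 k) := by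
      intro b hb b' hb' h
      simp only [Finset.coe_Icc, Set.mem_Icc] at hb hb'
      simp only at h
      omega
    have himg : Finset.image (fun b => j + k + 1 - b) (Finset.Icc 1 k) = Finset.Ioc j (j + k) := by
      ext b
      simp only [Finset.mem_image, Finset.mem_Icc, Finset.mem_Ioc]
      constructor
      · rintro ⟨b', hb', rfl⟩; omega
      · intro hb; exact ⟨j + k + 1 - b, by omega, by omega⟩
    rw [← himg, Finset.sum_image hinj]
  rw [h1]
  exact h2.trans (le_of_eq h3)

/-! ### 3. One light block (and no block) for monotone laws -/

/-- **The profile inequality for one light block, monotone hub law, pure form.**  Let `p ≥ 0` be nondecreasing on `[1, 2j−a]`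
(`a ≤ j`), `2j − a + 1 ≤ m ≤ M` and `j ≤ M·g` (`g` real).  Then
`Σ_{b ≤ m} b·p b ≤ M · Σ_{b ≤ m} p b·(1[j < b] + g·1[j − a < b ≤ j])`.
Proof: levels `b > 2j − a` have weight `M − b ≥ 0`, levels `j − a < b ≤ j` have `M g − b ≥ 0`, and the deficit `Σ_{b ≤ j−a} b·p b` is paid by
the levels `(j, 2j−a]` through `Quant.reflect_pairing` (`k = j − a`). [this work] -/
theorem mono_profile_oneLightBlock (p : ℕ → ℝ) (m j a : ℕ) (M g : ℝ) (haj : a ≤ j)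
    (hp0 : ∀ b, 0 ≤ p b) (hmono : ∀ b b' : ℕ, 1 ≤ b → b ≤ b' → b' ≤ 2 * j - a → p b ≤ p b')
    (hm : 2 * j - a + 1 ≤ m) (hM : (m : ℝ) ≤ M) (hMg : (j : ℝ) ≤ M * g) :
    ∑ b ∈ Finset.range (m + 1), (b : ℝ) * p b ≤
      M * ∑ b ∈ Finset.range (m + 1), p b *
        ((if j < b then (1 : ℝ) else 0) + g * (if j - a < b ∧ b ≤ j then (1 : ℝ) else 0)) := by
  set k : ℕ := j - a with hk
  have hkj : k ≤ j := by omega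
  have hjk : j + k = 2 * j - a := by omega
  -- termwise: `b p b ≤ M p b (…) + [b ≤ k] b p b − [j < b ≤ j+k] (M − b) p b`
  have key : ∀ b ∈ Finset.range (m + 1), (b : ℝ) * p b ≤
      M * (p b * ((if j < b then (1 : ℝ) else 0) + g * (if j - a < b ∧ b ≤ j then (1 : ℝ) else 0))) +
        (if b ≤ k then (b : ℝ) * p b else 0) - (if j < b ∧ b ≤ j + k then (M - b) * p b else 0) := by
    intro b hb
    have hbm : b ≤ m := by have := Finset.mem_range.1 hb; omega
    have hbM : (b : ℝ) ≤ M := (show (b : ℝ) ≤ m by exact_mod_cast hbm).trans hM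
    have hpb := hp0 b
    by_cases h1 : b ≤ k
    · have c1 : ¬ j < b := by omega
      have c2 : ¬ (j - a < b ∧ b ≤ j) := by omega
      have c3 : ¬ (j < b ∧ b ≤ j + k) := by omega
      rw [if_neg c1, if_neg c2, if_pos h1, if_neg c3]
      have e : M * (p b * ((0 : ℝ) + g * 0)) = 0 := by ring
      linarith
    · by_cases h2 : b ≤ j
      · have c1 : ¬ j < b := by omega
        have c2 : (j - a < b ∧ b ≤ j) := by omega
        have c3 : ¬ (j < b ∧ b ≤ j + k) := by omega
        rw [if_neg c1, if_pos c2, if_neg h1, if_neg c3]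
        have hbj : (b : ℝ) ≤ j := by exact_mod_cast h2
        have e1 : (b : ℝ) * p b ≤ j * p b := mul_le_mul_of_nonneg_right hbj hpb
        have e2 : (j : ℝ) * p b ≤ (M * g) * p b := mul_le_mul_of_nonneg_right hMg hpb
        have e : M * (p b * ((0 : ℝ) + g * 1)) = (M * g) * p b := by ring
        linarith
      · by_cases h3 : b ≤ j + k
        · have c1 : j < b := by omega
          have c2 : ¬ (j - a < b ∧ b ≤ j) := by omega
          have c3 : (j < b ∧ b ≤ j + k) := by omega
          rw [if_pos c1, if_neg c2, if_neg h1, if_pos c3]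
          have e : M * (p b * ((1 : ℝ) + g * 0)) = M * p b := by ring
          linarith
        · have c1 : j < b := by omega
          have c2 : ¬ (j - a < b ∧ b ≤ j) := by omega
          have c3 : ¬ (j < b ∧ b ≤ j + k) := by omega
          rw [if_pos c1, if_neg c2, if_neg h1, if_neg c3]
          have e3 : (b : ℝ) * p b ≤ M * p b := mul_le_mul_of_nonneg_right hbM hpb
          have e : M * (p b * ((1 : ℝ) + g * 0)) = M * p b := by ring
          linarith
  have hS := Finset.sum_le_sum key
  rw [Finset.sum_sub_distrib, Finset.sum_add_distrib, ← Finset.mul_sum] at hS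
  -- identify the two correction sums
  have e1 : ∑ b ∈ Finset.range (m + 1), (if b ≤ k then (b : ℝ) * p b else 0) =
      ∑ b ∈ Finset.range (k + 1), (b : ℝ) * p b := by
    rw [← Finset.sum_filter]
    congr 1
    ext b; simp only [Finset.mem_filter, Finset.mem_range]; omega
  have e2 : ∑ b ∈ Finset.range (m + 1), (if j < b ∧ b ≤ j + k then (M - b) * p b else 0) =
      ∑ b ∈ Finset.Ioc j (j + k), (M - b) * p b := by
    rw [← Finset.sum_filter]
    congr 1
    ext b; simp only [Finset.mem_filter, Finset.mem_range, Finset.mem_Ioc]; omega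
  have hpair := reflect_pairing p j k M hkj (by
      have : ((2 * j - a : ℕ) : ℝ) + 1 ≤ m := by exact_mod_cast hm
      have e : ((2 * j - a : ℕ) : ℝ) = (j : ℝ) + k := by rw [← hjk]; push_cast; ring
      linarith) hp0 (fun b b' hb hbb' hb' => hmono b b' hb hbb' (by omega))
  rw [e1, e2] at hS
  linarith

/-! ### 4. The block sum of a single block -/

variable {n : ℕ}

/-- The block sum of `K = {x}` is `size x·1[x ∈ ω]`. [folklore] -/
theorem singleton_blockSum_eq (x : Fin n) (size : Fin n → ℕ) (ω : Set (Fin n)) :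
    ∑ y ∈ ({x} : Finset (Fin n)).filter (fun y => y ∈ ω), size y = if x ∈ ω then size x else 0 := by
  rw [Finset.filter_singleton]
  split_ifs with h
  · exact Finset.sum_singleton _ _
  · exact Finset.sum_empty

/-- **Levels of a single block.**  `P(i ≤ W) = 1` for `i = 0`, `= q x` for `1 ≤ i ≤ size x`, `= 0` for `i > size x`, where `W = size x·1[x ∈ ω]`.
[folklore] -/
theorem singleton_blockSum_real (q : Fin n → unitInterval) (x : Fin n) (size : Fin n → ℕ) (i : ℕ) :
    (prodBernoulli q).real {ω : Set (Fin n) | i ≤ ∑ y ∈ ({x} : Finset (Fin n)).filter (fun y => y ∈ ω), size y} =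
      if i = 0 then 1 else if i ≤ size x then (q x : ℝ) else 0 := by
  have hev : {ω : Set (Fin n) | i ≤ ∑ y ∈ ({x} : Finset (Fin n)).filter (fun y => y ∈ ω), size y} =
      {ω : Set (Fin n) | i ≤ if x ∈ ω then size x else 0} := by
    ext ω; rw [Set.mem_setOf_eq, Set.mem_setOf_eq, singleton_blockSum_eq]
  rw [hev]
  split_ifs with h0 h1
  · have : {ω : Set (Fin n) | i ≤ if x ∈ ω then size x else 0} = Set.univ := by
      ext ω; simp only [Set.mem_setOf_eq, Set.mem_univ, iff_true]; rw [h0]; exact Nat.zero_le _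
    rw [this, probReal_univ]
  · have : {ω : Set (Fin n) | i ≤ if x ∈ ω then size x else 0} = {ω | x ∈ ω} := by
      ext ω
      simp only [Set.mem_setOf_eq]
      constructor
      · intro h; by_contra hx; rw [if_neg hx] at h; omega
      · intro hx; rw [if_pos hx]; exact h1
    rw [this, prodBernoulli_real_setOf_mem]
  · have : {ω : Set (Fin n) | i ≤ if x ∈ ω then size x else 0} = ∅ := by
      ext ω
      simp only [Set.mem_setOf_eq, Set.mem_empty_iff_false, iff_false, not_le]
      split_ifs <;> omega
    rw [this, measureReal_empty]

end Quant

end Summit.CriticalPhenomena.PercolationContinuityZ3.Theorems
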